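import Summits.Ventures.PercRepro.Night2FirstLayer
import Summits.Ventures.PercRepro.RankLevelSet

/-!
# PercRepro — night-2: the first-layer reduction in the cell's counting vocabulary (blind cell pub-perc-repro)

Bridges `Night2FirstLayer` (Theorem 3 on `Finset` families) to typer-2's `levelCount` / `topCount`
(`MatroidColoopStepA`): `levelCount_eq_card_levelFam`, `topCount_eq_card_topFam`;
`LevelOne M p q := C(p+q, q+1) · topCount M p q ≤ C(p+q, p) · levelCount M (q+1)` (level `q+1` of `Levelwise M p q`;
at `p = q+2` it is the row C-025 itself); `levelOne_of_perFlat` (THEOREM 3); Proposition 4 / Corollary 5: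
`perFlat_term_of_cospanning`, `levelOne_of_cospanning` — a flat whose complement spans satisfies (L1-F) automatically;
`c025_diag_of_levelOne` — at `p = q + 2`, `LevelOne M (q+2) q` is literally the body of the row `C025` (typer-2 `RankLevelSet.lean`):
`phiK (q+2) q · #{A : ρA = q+2, ρ(E∖A) = q} ≤ #{A : q < ρA < q+2}` — so `PerFlat M E (q+2) q` for every `q` would be the whole diagonal.
-/

namespace PercRepro
namespace Matroid

open Set Finset
open scoped Classical

variable {α : Type*} {M : _root_.Matroid α} {E : Finset α} {p q : ℕ}

section Bridge


/-- `W_u = |𝒮_u|`: typer-2's `levelCount` is the cardinality of `levelFam` when `E` is the ground set. -/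
theorem levelCount_eq_card_levelFam (hE : (↑E : Set α) = M.E) (u : ℕ) :
    levelCount M u = (levelFam M E u).card := by
  unfold levelCount
  have hset : {S : Set α | S ⊆ M.E ∧ M.eRk S = (u : ℕ∞)} =
      (fun T : Finset α => (↑T : Set α)) '' (↑(levelFam M E u) : Set (Finset α)) := by
    ext S
    constructor
    · rintro ⟨hS, hr⟩
      have hSE : S ⊆ (↑E : Set α) := hE ▸ hS
      have hfin : S.Finite := E.finite_toSet.subset hSE
      refine ⟨hfin.toFinset, ?_, hfin.coe_toFinset⟩
      rw [Finset.mem_coe, mem_levelFam_iff, hfin.coe_toFinset]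
      exact ⟨fun x hx => Finset.mem_coe.1 (hSE (hfin.mem_toFinset.1 hx)), hr⟩
    · rintro ⟨T, hT, rfl⟩
      rw [Finset.mem_coe, mem_levelFam_iff] at hT
      exact ⟨hE ▸ Finset.coe_subset.2 hT.1, hT.2⟩
  rw [hset, Set.ncard_image_of_injective _ Finset.coe_injective, Set.ncard_coe_finset]

/-- `#U(p,q)` (typer-2's `topCount`, on the sets `A` with `r(A) = p`, `r(E ∖ A) = q`) is `|U|` (on the complements). -/
theorem topCount_eq_card_topFam (hE : (↑E : Set α) = M.E) :
    topCount M p q = (topFam M E p q).card := by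
  unfold topCount
  have hset : {A : Set α | A ⊆ M.E ∧ M.eRk A = (p : ℕ∞) ∧ M.eRk (M.E \ A) = (q : ℕ∞)} =
      (fun B : Finset α => (↑E : Set α) \ ↑B) '' (↑(topFam M E p q) : Set (Finset α)) := by
    ext A
    constructor
    · rintro ⟨hA, hp, hq⟩
      have hAE : A ⊆ (↑E : Set α) := hE ▸ hA
      have hfin : A.Finite := E.finite_toSet.subset hAE
      refine ⟨E \ hfin.toFinset, ?_, ?_⟩
      · rw [Finset.mem_coe, mem_topFam_iff, Finset.coe_sdiff, hfin.coe_toFinset,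
          Set.sdiff_sdiff_cancel_left hAE]
        refine ⟨Finset.sdiff_subset, ?_, hp⟩
        rw [← hE] at hq; exact hq
      · show (↑E : Set α) \ ↑(E \ hfin.toFinset) = A
        rw [Finset.coe_sdiff, hfin.coe_toFinset, Set.sdiff_sdiff_cancel_left hAE]
    · rintro ⟨B, hB, rfl⟩
      rw [Finset.mem_coe, mem_topFam_iff] at hB
      refine ⟨hE ▸ Set.sdiff_subset, hB.2.2, ?_⟩
      rw [← hE, Set.sdiff_sdiff_cancel_left (Finset.coe_subset.2 hB.1)]
      exact hB.2.1
  have hinj : Set.InjOn (fun B : Finset α => (↑E : Set α) \ ↑B) (↑(topFam M E p q) : Set (Finset α)) := by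
    intro B₁ hB₁ B₂ hB₂ h
    have h1 := (mem_topFam_iff.1 (Finset.mem_coe.1 hB₁)).1
    have h2 := (mem_topFam_iff.1 (Finset.mem_coe.1 hB₂)).1
    apply Finset.coe_injective
    have := congrArg (fun X : Set α => (↑E : Set α) \ X) h
    simpa [Set.sdiff_sdiff_cancel_left (Finset.coe_subset.2 h1),
      Set.sdiff_sdiff_cancel_left (Finset.coe_subset.2 h2)] using this
  rw [hset, hinj.ncard_image, Set.ncard_coe_finset]

/-- **THEOREM 3 in the cell's vocabulary**: (L1-F) for every flat ⟹ `p · #U(p,q) ≤ (q+1) · W_{q+1}`. -/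
theorem count_firstLayer_of_perFlat (hE : (↑E : Set α) = M.E) (h : PerFlat M E p q) :
    (p : ℚ) * topCount M p q ≤ (q + 1) * levelCount M (q + 1) := by
  rw [topCount_eq_card_topFam hE, levelCount_eq_card_levelFam hE]
  exact firstLayer_of_perFlat hE.le h

/-- The level `u = q + 1` of typer-2's level-wise form `Levelwise M p q`:
`C(p+q, q+1) · #U(p,q) ≤ C(p+q, p) · W_{q+1}`. Intended for `q + 2 ≤ p` (the range of the row C-025); at `p = q + 1` it is the
trivial injection `A ↦ A`, and for `p ≤ q` it may fail (then `W_{q+1}` can vanish while `#U(p,q) > 0`). -/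
def LevelOne (M : _root_.Matroid α) (p q : ℕ) : Prop :=
  (p + q).choose (q + 1) * topCount M p q ≤ (p + q).choose p * levelCount M (q + 1)

/-- `Levelwise M p q` implies `LevelOne M p q` (it is its level `q + 1`). -/
theorem LevelOne.of_levelwise (h : Levelwise M p q) : LevelOne M p q := h (q + 1)

/-- `C(p+q, q+1) · (q+1) = C(p+q, p) · p`. -/
theorem choose_succ_mul_eq (p q : ℕ) : (p + q).choose (q + 1) * (q + 1) = (p + q).choose p * p := by
  have h1 := Nat.choose_succ_right_eq (p + q) q
  have h2 : (p + q).choose q = (p + q).choose p := by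
    rw [← Nat.choose_symm (by omega : q ≤ p + q)]
    congr 1; omega
  rw [h1, h2]; congr 1; omega

/-- **THEOREM 3, level-wise form**: (L1-F) for every flat carrying a `U`-set ⟹ `LevelOne M p q`. -/
theorem levelOne_of_perFlat (hE : (↑E : Set α) = M.E) (h : PerFlat M E p q) : LevelOne M p q := by
  unfold LevelOne
  have hmain := count_firstLayer_of_perFlat hE h
  have hc : ((p + q).choose (q + 1) : ℚ) * (q + 1) = (p + q).choose p * p := by
    exact_mod_cast choose_succ_mul_eq p q
  have hq1 : (0 : ℚ) < q + 1 := by positivity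
  have hchoose : (0 : ℚ) ≤ (p + q).choose p := by positivity
  have : ((p + q).choose (q + 1) : ℚ) * topCount M p q ≤ (p + q).choose p * levelCount M (q + 1) := by
    have h3 : ((p + q).choose (q + 1) : ℚ) * (q + 1) * topCount M p q ≤
        ((p + q).choose p : ℚ) * ((q + 1) * levelCount M (q + 1)) := by
      rw [hc, mul_assoc]
      exact mul_le_mul_of_nonneg_left hmain hchoose
    have h4 : ((p + q).choose (q + 1) : ℚ) * (q + 1) * topCount M p q =
        (q + 1) * (((p + q).choose (q + 1) : ℚ) * topCount M p q) := by ring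
    have h5 : ((p + q).choose p : ℚ) * ((q + 1) * levelCount M (q + 1)) =
        (q + 1) * (((p + q).choose p : ℚ) * levelCount M (q + 1)) := by ring
    rw [h4, h5] at h3
    exact le_of_mul_le_mul_left h3 hq1
  exact_mod_cast this

end Bridge


section Cospanning


/-- `|K(T)| ≤ q` for `T ∈ 𝒯`. -/
theorem card_coloopsF_le_of_mem_upFam (hE : (↑E : Set α) ⊆ M.E) {T : Finset α} (hT : T ∈ upFam M E p q) :
    (coloopsF M T).card ≤ q := by
  rw [mem_upFam_iff] at hT
  have h := ncard_setColoops_le (M := M) (X := (↑T : Set α)) ((Finset.coe_subset.2 hT.1).trans hE)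
    (Finset.finite_toSet T) hT.2.1
  rwa [← coe_coloopsF, Set.ncard_coe_finset] at h

/-- `|E ∖ cl T| ≥ r(E ∖ cl T)`. -/
theorem eRk_le_card_outside (T : Finset α) :
    M.eRk ((↑E : Set α) \ M.closure (↑T : Set α)) ≤ ((outside M E T).card : ℕ∞) := by
  have hcoe : (↑(outside M E T) : Set α) = (↑E : Set α) \ M.closure (↑T : Set α) := by
    ext x; simp [outside]
  rw [← hcoe, ← Set.encard_coe_eq_coe_finsetCard]
  exact M.eRk_le_encard _

/-- **Proposition 4.** A flat `F` whose complement spans (`r(E ∖ F) = p`, i.e. `t₀ = 0`) satisfies (L1-F):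
`|E ∖ F| ≥ p`, every `T ∈ 𝒯_F` has `|K(T)| ≤ q`, and `U_F ⊆ 𝒯_F`. -/
theorem perFlat_term_of_cospanning (hE : (↑E : Set α) ⊆ M.E) {F : Set α}
    (hco : M.eRk ((↑E : Set α) \ F) = (p : ℕ∞)) :
    (p : ℚ) * (topFamF M E p q F).card ≤
      (q + 1) * ∑ T ∈ upFamF M E p q F, ((outside M E T).card : ℚ) / ((coloopsF M T).card + 1) := by
  have hterm : ∀ T ∈ upFamF M E p q F,
      (p : ℚ) / (q + 1) ≤ ((outside M E T).card : ℚ) / ((coloopsF M T).card + 1) := by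
    intro T hT
    rw [upFamF, Finset.mem_filter] at hT
    have h1 : (p : ℚ) ≤ (outside M E T).card := by
      have := eRk_le_card_outside (M := M) (E := E) T
      rw [hT.2, hco] at this
      exact_mod_cast this
    have h2 : ((coloopsF M T).card : ℚ) + 1 ≤ q + 1 := by
      have := card_coloopsF_le_of_mem_upFam hE hT.1
      exact_mod_cast Nat.succ_le_succ this
    have hpos : (0 : ℚ) < (coloopsF M T).card + 1 := by positivity
    calc (p : ℚ) / (q + 1) ≤ (p : ℚ) / ((coloopsF M T).card + 1) := by
          apply div_le_div_of_nonneg_left (by positivity) hpos h2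
      _ ≤ ((outside M E T).card : ℚ) / ((coloopsF M T).card + 1) := by
          apply div_le_div_of_nonneg_right h1 hpos.le
  have hsub : topFamF M E p q F ⊆ upFamF M E p q F :=
    Finset.filter_subset_filter _ topFam_subset_upFam
  have hq1 : (0 : ℚ) < q + 1 := by positivity
  have hA : (p : ℚ) * (topFamF M E p q F).card = (q + 1) * ∑ _T ∈ topFamF M E p q F, (p : ℚ) / (q + 1) := by
    rw [Finset.sum_const, nsmul_eq_mul]; field_simp
  have hB : ∑ _T ∈ topFamF M E p q F, (p : ℚ) / (q + 1) ≤ ∑ _T ∈ upFamF M E p q F, (p : ℚ) / (q + 1) :=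
    Finset.sum_le_sum_of_subset_of_nonneg hsub (fun _ _ _ => by positivity)
  have hC : ∑ _T ∈ upFamF M E p q F, (p : ℚ) / (q + 1) ≤
      ∑ T ∈ upFamF M E p q F, ((outside M E T).card : ℚ) / ((coloopsF M T).card + 1) :=
    Finset.sum_le_sum hterm
  rw [hA]
  exact mul_le_mul_of_nonneg_left (hB.trans hC) hq1.le

/-- **Corollary 5.** If every flat carrying a `U`-set is co-spanning (`r(E ∖ F) = p`), then (L1-F) holds
everywhere, hence `LevelOne M p q`. -/
theorem levelOne_of_cospanning (hE : (↑E : Set α) = M.E)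
    (hco : ∀ F ∈ flatsU M E p q, M.eRk ((↑E : Set α) \ F) = (p : ℕ∞)) : LevelOne M p q :=
  levelOne_of_perFlat hE (fun F hF => perFlat_term_of_cospanning hE.le (hco F hF))

end Cospanning


section Diagonal

/-- `Finset.Ioo q (q+2) = {q+1}`. -/
theorem ioo_succ_succ (q : ℕ) : Finset.Ioo q (q + 2) = {q + 1} := by
  ext x; simp only [Finset.mem_Ioo, Finset.mem_singleton]; omega

/-- `Φ(q+2, q) = C(2q+2, q+1) / C(2q+2, q+2)`. -/
theorem phiK_diag (q : ℕ) :
    phiK (q + 2) q = ((q + 2 + q).choose (q + 1) : ℚ) / ((q + 2 + q).choose (q + 2) : ℚ) := by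
  unfold phiK
  rw [ioo_succ_succ, Finset.sum_singleton]

/-- In `ℕ∞`, `q < x < q + 2` means `x = q + 1`. -/
theorem enat_between_iff (q : ℕ) (x : ℕ∞) :
    ((q : ℕ∞) < x ∧ x < ((q + 2 : ℕ) : ℕ∞)) ↔ x = ((q + 1 : ℕ) : ℕ∞) := by
  cases x using ENat.recTopCoe with
  | top =>
    simp only [not_top_lt, and_false, false_iff]
    exact fun h => absurd h (ENat.top_ne_coe _)
  | coe n =>
    simp only [Nat.cast_lt, Nat.cast_inj]
    omega

/-- The middle level set of the diagonal `(q+2, q)` is the level set `r = q+1`. -/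
theorem middle_set_diag (M : _root_.Matroid α) (q : ℕ) :
    {A : Set α | A ⊆ M.E ∧ (q : ℕ∞) < M.eRk A ∧ M.eRk A < ((q + 2 : ℕ) : ℕ∞)} =
      {A : Set α | A ⊆ M.E ∧ M.eRk A = ((q + 1 : ℕ) : ℕ∞)} := by
  ext A
  simp only [Set.mem_setOf_eq, ← enat_between_iff q (M.eRk A)]

/-- **The diagonal of C-025 from `LevelOne`**: at `p = q + 2`, `LevelOne M (q+2) q` is exactly the body of the row `C025`
(typer-2 `RankLevelSet.lean`): `Φ(q+2, q) · #{A : ρA = q+2, ρ(E∖A) = q} ≤ #{A : q < ρA < q+2}`. -/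
theorem c025_diag_of_levelOne (M : _root_.Matroid α) (q : ℕ) (h : LevelOne M (q + 2) q) :
    phiK (q + 2) q * (({A : Set α | A ⊆ M.E ∧ M.eRk A = ((q + 2 : ℕ) : ℕ∞) ∧
        M.eRk (M.E \ A) = (q : ℕ∞)}.ncard : ℚ)) ≤
      (({A : Set α | A ⊆ M.E ∧ (q : ℕ∞) < M.eRk A ∧ M.eRk A < ((q + 2 : ℕ) : ℕ∞)}.ncard : ℚ)) := by
  rw [middle_set_diag, phiK_diag]
  unfold LevelOne at h
  have hpos : (0 : ℚ) < ((q + 2 + q).choose (q + 2) : ℚ) := by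
    exact_mod_cast Nat.choose_pos (by omega)
  have h' : (((q + 2 + q).choose (q + 1) : ℕ) : ℚ) * (topCount M (q + 2) q : ℚ) ≤
      (((q + 2 + q).choose (q + 2) : ℕ) : ℚ) * (levelCount M (q + 1) : ℚ) := by
    exact_mod_cast h
  rw [div_mul_eq_mul_div, div_le_iff₀ hpos]
  unfold topCount levelCount at h'
  calc (((q + 2 + q).choose (q + 1) : ℚ)) *
        (({A : Set α | A ⊆ M.E ∧ M.eRk A = ((q + 2 : ℕ) : ℕ∞) ∧ M.eRk (M.E \ A) = (q : ℕ∞)}.ncard : ℚ))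
      = (((q + 2 + q).choose (q + 1) : ℕ) : ℚ) *
        (({A : Set α | A ⊆ M.E ∧ M.eRk A = ((q + 2 : ℕ) : ℕ∞) ∧ M.eRk (M.E \ A) = (q : ℕ∞)}.ncard : ℚ)) := by
          push_cast; ring
    _ ≤ _ := h'
    _ = _ := by push_cast; ring

end Diagonal

end Matroid
end PercRepro
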